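import Mathlib
import HarnessLib
import Literature.Geometry.Lorentzian.KerrFiniteSpeedOfPropagation
import Literature.Geometry.Lorentzian.KerrTimeDerivative
import Literature.Geometry.Lorentzian.AFLinearUniqueness

/-!
# Route ZeroEnergyKerrOrBomb · item `KerrModeStability` — local uniqueness (inner domain of
# dependence) for the wave equation on the Kerr exterior, horizon-penetrating chart

Helper file for item stmt-FinalStateConjecture-10024 (`KerrModeStability`). The tree proves the
*outer* domain-of-dependence property of the Kerr–Schild leaf `{t* = 0} ∩ {r > r₊}`
(`kerr_finite_speed_of_propagation_holds`, `KerrFiniteSpeedOfPropagation.lean`: data vanishing on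
`{‖y‖ > ρ}` give a solution vanishing on `{‖x⃗‖ > ρ + t*}`). The energy argument there is local:
its weight `W = χ(2t* + 2) χ(R − t* − (ε₁² + ‖y − y₀‖²)^{1/2}) χ(δ⁻¹(r − r_in(t*)))` is supported,
at `t* = 0`, in the ball `{‖y − y₀‖ < R}` (intersected with `{r > r_in(0)} ⊆ {r > r₊}`). This file
records the resulting **local uniqueness** statement, for smooth functions on a
horizon-penetrating chart `Kerr.region a r₀`, `r₀ ≤ r₊`, solving `□_g ψ = 0` on the exterior
`{r > r₊}` only (the class of the item):

* `kerr_local_uniqueness` — if `dψ̃ = 0` on the exterior slice ball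
  `{t* = 0, ‖y − y₀‖ < R₀, r > r₊}` and `ψ̃(0, y₀) = 0` (`ψ̃` the extension by zero), then
  `ψ̃ = 0` and `dψ̃ = 0` at every exterior point `(t₀, y₀)` with `0 ≤ t₀ < R₀`;
* `kerr_fderiv_eq_of_data_eqOn` — two functions with the same values on an open piece of the slice
  and the same `∂_{t*}`-derivative at a point of it have the same differential there;
* `kerr_local_uniqueness_two` — two such solutions with the same Cauchy data
  (`ψ`, `∂_{t*}ψ`) on the exterior slice ball agree, with their differentials, at `(t₀, y₀)`.

Sources: Bär–Ginoux–Pfäffle 2007, Thm. 3.2.11 / Cor. 3.2.4 (uniqueness and `supp u ⊂ J(supp data)`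
for normally hyperbolic operators); Hawking–Ellis 1973, §4.3 (conservation theorem), as mechanised
in `KerrSchild.Background.fderiv_eq_zero_of_weight`. No new definitions.
-/

noncomputable section

namespace Summit.FinalStateConjecture.FinalStateConjecture.Theorems

open Literature.Geometry.Lorentzian Set Filter
open scoped Manifold ContDiff Topology

-- every `Summit.FinalStateConjecture.FinalStateConjecture.…` name repeats the summit = sub-problem segment (D-0017 layout)
set_option linter.dupNamespace false

/-- Points with `r > r₊` lie in every chart domain `Kerr.region a r₀` with `r₀ ≤ r₊` (for
subextremal parameters, where `r₊ > 0`). -/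
theorem kerr_mem_region_of_rPlus_lt {M a r₀ : ℝ} (hMa : Kerr.IsSubextremal M a)
    (hr₀ : r₀ ≤ Kerr.rPlus M a) {z : E4} (hz : Kerr.rPlus M a < Kerr.radius a z) :
    z ∈ Kerr.region a r₀ := by
  rw [Kerr.mem_region]
  exact max_lt (lt_of_le_of_lt hr₀ hz) (hMa.rPlus_pos.trans hz)

/-- Points with `r > r₊` lie in the exterior chart `Kerr.exterior M a` (subextremal parameters). -/
theorem kerr_mem_exterior_of_rPlus_lt {M a : ℝ} (hMa : Kerr.IsSubextremal M a) {z : E4}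
    (hz : Kerr.rPlus M a < Kerr.radius a z) : z ∈ Kerr.exterior M a := by
  rw [Kerr.mem_exterior, max_eq_left hMa.rPlus_pos.le]
  exact hz

/-- Points of the exterior chart have `r > r₊` (subextremal parameters). -/
theorem kerr_rPlus_lt_of_mem_exterior {M a : ℝ} (hMa : Kerr.IsSubextremal M a) {z : E4}
    (hz : z ∈ Kerr.exterior M a) : Kerr.rPlus M a < Kerr.radius a z := by
  have := Kerr.mem_exterior.mp hz
  rwa [max_eq_left hMa.rPlus_pos.le] at this

/-- **Local uniqueness (inner domain of dependence) on the Kerr exterior, horizon-penetrating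
chart.** Let `(M, a)` be subextremal, `r₀ ≤ r₊`, and `ψ` smooth on `Kerr.region a r₀` with
`□_g ψ = 0` at every point with `r > r₊`; write `ψ̃` for its extension by zero to `ℝ⁴`. If
`dψ̃ = 0` at all exterior slice points `(0, y)` with `‖y − y₀‖ < R₀`, and `ψ̃(0, y₀) = 0`, then
`ψ̃(x) = 0` and `dψ̃(x) = 0` at every exterior point `x = (t₀, y₀)` with `0 ≤ t₀ < R₀`.
Proof: the weighted conservation theorem `KerrSchild.Background.fderiv_eq_zero_of_weight` on the
surgered Kerr–Schild background with the weight of `Kerr.dependenceWeight_flux_nonpos`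
(cone factor of slope `1` around `y₀` with `t₀ < R < R₀`, horizon factor receding like
`r₊ + ε e^{(t* − t₀)/2M}`), exactly as in `kerr_finite_speed_of_propagation_holds`; the initial
support of the weight lies in the exterior slice ball where the data vanish. Bär–Ginoux–Pfäffle
2007, Cor. 3.2.4; Hawking–Ellis 1973, §4.3. -/
theorem kerr_local_uniqueness [Kerr.Facts] [Kerr.SliceFacts] {M a r₀ : ℝ}
    (hMa : Kerr.IsSubextremal M a) (hr₀ : r₀ ≤ Kerr.rPlus M a) {ψ : Kerr.region a r₀ → ℝ}
    (hψ : ContMDiff 𝓘(ℝ, E4) 𝓘(ℝ, ℝ) ∞ ψ)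
    (hsol : ∀ x : Kerr.region a r₀, Kerr.rPlus M a < Kerr.radius a x.1 →
      (Kerr.smoothMetric M a r₀).toPseudoRiemannianMetric.dalembertian ψ x = 0)
    {y₀ : E3} {R₀ : ℝ}
    (hdata : ∀ z : E4, Kerr.rPlus M a < Kerr.radius a z → z 0 = 0 → ‖E4.spatial z - y₀‖ < R₀ →
      fderiv ℝ (Function.extend Subtype.val ψ 0) z = 0)
    (hdata0 : Function.extend Subtype.val ψ 0 (E4.ofTimeSpace 0 y₀) = 0)
    {x : E4} (hx : Kerr.rPlus M a < Kerr.radius a x) (hx0 : 0 ≤ x 0) (hxR : x 0 < R₀)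
    (hxy : E4.spatial x = y₀) :
    Function.extend Subtype.val ψ 0 x = 0 ∧ fderiv ℝ (Function.extend Subtype.val ψ 0) x = 0 := by
  classical
  have hM : 0 < M := hMa.pos
  have hrp : 0 < Kerr.rPlus M a := hMa.rPlus_pos
  -- ### the representative `Φ` of `ψ`
  set Φ : E4 → ℝ := Function.extend Subtype.val ψ 0 with hΦ_def
  have hrep : ∀ y : Kerr.region a r₀, ψ y = Φ y := extend_rep ψ
  have hreg : ∀ z : E4, Kerr.rPlus M a < Kerr.radius a z → z ∈ Kerr.region a r₀ := fun z hz ↦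
    kerr_mem_region_of_rPlus_lt hMa hr₀ hz
  have hΦat : ∀ z : E4, Kerr.rPlus M a < Kerr.radius a z → ContDiffAt ℝ ∞ Φ z := fun z hz ↦
    contDiffAt_extend hψ ⟨z, hreg z hz⟩
  have hΦ2 : ∀ z ∈ (Kerr.exterior M a : Set E4), ContDiffAt ℝ 2 Φ z := fun z hz ↦
    (hΦat z (kerr_rPlus_lt_of_mem_exterior hMa hz)).of_le (WithTop.coe_le_coe.mpr le_top)
  have hΦd : ∀ z : E4, Kerr.rPlus M a < Kerr.radius a z → DifferentiableAt ℝ Φ z := fun z hz ↦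
    (hΦat z hz).differentiableAt (by simp)
  -- ### the background and the wave equation in divergence form on the exterior
  set B := Kerr.surgeryBackground M a (Kerr.rPlus M a) hM.le hrp with hB
  have hwave : ∀ z ∈ (Kerr.exterior M a : Set E4),
      KerrSchild.waveOperator B.inverseMetric Φ z = 0 := by
    intro z hz
    have hzr := kerr_rPlus_lt_of_mem_exterior hMa hz
    have h1 := Kerr.dalembertian_eq_waveOperator M a r₀ hrep ⟨z, hreg z hzr⟩ (hΦ2 z hz)
    rw [KerrSchild.waveOperator_congr_of_eventuallyEq
      (Kerr.surgeryBackground_inverseMetric_eventuallyEq M a hM.le hrp ⟨z, hz⟩) Φ] at h1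
    rw [← h1]
    exact hsol ⟨z, hreg z hzr⟩ hzr
  -- ### the point `x = (t₀, y₀)`
  set t₀ : ℝ := x 0 with ht₀
  have hxeq : x = E4.ofTimeSpace t₀ y₀ := by
    rw [← hxy]; exact (E4.ofTimeSpace_time_spatial x).symm
  rcases hx0.eq_or_lt with ht00 | ht0pos
  · -- a slice point of the ball
    have hdx : fderiv ℝ Φ x = 0 := hdata x hx ht00.symm (by rw [hxy, sub_self, norm_zero]; linarith)
    refine ⟨?_, hdx⟩
    rw [hxeq, ← ht00]
    exact hdata0
  have hrad : ∀ t : ℝ, Kerr.radius a (E4.ofTimeSpace t y₀) = Kerr.radius a x := by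
    intro t
    rw [hxeq, Kerr.radius_ofTimeSpace a t y₀, Kerr.radius_ofTimeSpace a t₀ y₀]
  have hmem_t : ∀ t : ℝ, E4.ofTimeSpace t y₀ ∈ Kerr.exterior M a := fun t ↦
    kerr_mem_exterior_of_rPlus_lt hMa (by rw [hrad t]; exact hx)
  -- ### constants
  set R : ℝ := (t₀ + R₀) / 2 with hR
  have hR1 : t₀ < R := by rw [hR]; linarith
  have hR2 : R < R₀ := by rw [hR]; linarith
  set ε₁ : ℝ := (R - t₀) / 2 with hε₁
  have hε₁0 : 0 < ε₁ := by rw [hε₁]; linarith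
  have hε₁R : ε₁ < R - t₀ := by rw [hε₁]; linarith
  set ε : ℝ := (Kerr.radius a x - Kerr.rPlus M a) / 2 with hε
  have hε0 : 0 < ε := by rw [hε]; linarith
  have hεr : Kerr.rPlus M a + ε < Kerr.radius a x := by rw [hε]; linarith
  set δ : ℝ := ε * Real.exp (-t₀ / (2 * M)) with hδ
  have hδ0 : 0 < δ := mul_pos hε0 (Real.exp_pos _)
  set rK : ℝ := Kerr.rPlus M a + ε * Real.exp ((-1 - t₀) / (2 * M)) with hrK
  have hrK : Kerr.rPlus M a < rK := by
    rw [hrK]; linarith [mul_pos hε0 (Real.exp_pos ((-1 - t₀) / (2 * M)))]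
  have hrIn_mono : ∀ {s t : ℝ}, s ≤ t →
      Kerr.rPlus M a + ε * Real.exp ((s - t₀) / (2 * M)) ≤
        Kerr.rPlus M a + ε * Real.exp ((t - t₀) / (2 * M)) := by
    intro s t hst
    have : Real.exp ((s - t₀) / (2 * M)) ≤ Real.exp ((t - t₀) / (2 * M)) :=
      Real.exp_le_exp.mpr (div_le_div_of_nonneg_right (by linarith) (by linarith))
    nlinarith [hε0.le]
  -- ### the weight
  set W : E4 → ℝ := fun w ↦ Real.smoothTransition (2 * w 0 + 2) *
    (Real.smoothTransition (R - w 0 - √(ε₁ ^ 2 + ‖E4.spatial w - y₀‖ ^ 2)) *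
      Real.smoothTransition (δ⁻¹ * (Kerr.radius a w -
        (Kerr.rPlus M a + ε * Real.exp ((w 0 - t₀) / (2 * M)))))) with hW
  have hW1 : ContDiff ℝ 1 W :=
    Kerr.contDiff_dependenceWeight (n := 1) y₀ hε₁0.ne' hrp hε0.le hδ0
  have hW0 : ∀ w, 0 ≤ W w := fun w ↦
    Kerr.dependenceWeight_nonneg a (Kerr.rPlus M a) M t₀ R ε₁ ε δ y₀ w
  have hWsupp : ∀ w, W w ≠ 0 → -1 < w 0 ∧ ‖E4.spatial w - y₀‖ < R - w 0 ∧
      Kerr.rPlus M a + ε * Real.exp ((w 0 - t₀) / (2 * M)) < Kerr.radius a w :=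
    fun w hw ↦ Kerr.dependenceWeight_support hδ0 hw
  -- ### the compact set `K`
  set K : Set E4 := {w : E4 | w 0 ∈ Set.Icc (-1) R} ∩
    ({w : E4 | ‖E4.spatial w - y₀‖ ≤ R + 1} ∩ {w : E4 | rK ≤ Kerr.radius a w}) with hK
  have hKclosed : IsClosed K := by
    refine (isClosed_Icc.preimage (E4.dx 0).continuous).inter (IsClosed.inter ?_ ?_)
    · exact isClosed_le (continuous_norm.comp (E4.spatial.continuous.sub continuous_const))
        continuous_const
    · exact isClosed_le continuous_const (Kerr.continuous_radius a)
  have hKbdd : Bornology.IsBounded K := by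
    refine isBounded_iff_forall_norm_le.mpr ⟨(1 + |R|) + (R + 1 + ‖y₀‖), fun w hw ↦ ?_⟩
    obtain ⟨⟨h1, h2⟩, h3, -⟩ := hw
    have ht : |w 0| ≤ 1 + |R| := by
      rw [abs_le]
      constructor
      · linarith [abs_nonneg R]
      · linarith [le_abs_self R]
    have hs : E4.spatialNorm w ≤ R + 1 + ‖y₀‖ := by
      have : ‖E4.spatial w‖ ≤ ‖E4.spatial w - y₀‖ + ‖y₀‖ := by
        calc ‖E4.spatial w‖ = ‖(E4.spatial w - y₀) + y₀‖ := by rw [sub_add_cancel]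
          _ ≤ ‖E4.spatial w - y₀‖ + ‖y₀‖ := norm_add_le _ _
      have h3' : ‖E4.spatial w - y₀‖ ≤ R + 1 := h3
      change ‖E4.spatial w‖ ≤ _
      exact this.trans (by linarith [h3'])
    have hnorm : ‖w‖ ≤ |w 0| + E4.spatialNorm w := by
      have hs0 : 0 ≤ E4.spatialNorm w := E4.spatialNorm_nonneg w
      have hsq : ‖w‖ ^ 2 = w 0 ^ 2 + E4.spatialNorm w ^ 2 := by
        rw [EuclideanSpace.norm_sq_eq, Fin.sum_univ_four, E4.spatialNorm_sq]
        simp only [Real.norm_eq_abs, sq_abs]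
        ring
      have h2 : ‖w‖ ^ 2 ≤ (|w 0| + E4.spatialNorm w) ^ 2 := by
        rw [hsq]
        nlinarith [abs_nonneg (w 0), sq_abs (w 0)]
      exact (pow_le_pow_iff_left₀ (norm_nonneg w) (by positivity) two_ne_zero).mp h2
    linarith
  have hKc : IsCompact K := Metric.isCompact_of_isClosed_isBounded hKclosed hKbdd
  have hKU : K ⊆ (Kerr.exterior M a : Set E4) := fun w hw ↦
    kerr_mem_exterior_of_rPlus_lt hMa (hrK.trans_le hw.2.2)
  have hWK : ∀ w, W w ≠ 0 → w ∈ K := by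
    intro w hw
    obtain ⟨h1, h2, h3⟩ := hWsupp w hw
    have hn : 0 ≤ ‖E4.spatial w - y₀‖ := norm_nonneg _
    refine ⟨⟨h1.le, by linarith⟩, by show ‖E4.spatial w - y₀‖ ≤ R + 1; linarith, ?_⟩
    show rK ≤ Kerr.radius a w
    exact ((hrIn_mono (show (-1 : ℝ) ≤ w 0 by linarith)).trans h3.le)
  -- ### the hypotheses of the conservation theorem
  have hsolK : ∀ w ∈ K, KerrSchild.waveOperator B.inverseMetric Φ w = 0 := fun w hw ↦
    hwave w (hKU hw)
  have hflux : ∀ w ∈ K, 0 ≤ w 0 → w 0 ≤ t₀ →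
      ∑ μ, fderiv ℝ W w (E4.basisVector μ) *
        KerrSchild.normalCurrent B.inverseMetric Φ w μ ≤ 0 := fun w hw hw0 _ ↦
    Kerr.dependenceWeight_flux_nonpos hMa hM.le hrp hε₁0.ne' hε0 rfl y₀ Φ
      (hrK.trans_le hw.2.2) hw0
  have hdataW : ∀ w, w 0 = 0 → W w ≠ 0 → fderiv ℝ Φ w = 0 := by
    intro w hw0 hw
    obtain ⟨-, h2, h3⟩ := hWsupp w hw
    rw [hw0, sub_zero] at h2
    have hwr : Kerr.rPlus M a < Kerr.radius a w := by
      refine lt_of_le_of_lt ?_ h3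
      linarith [mul_pos hε0 (Real.exp_pos ((w 0 - t₀) / (2 * M)))]
    exact hdata w hwr hw0 (h2.trans hR2)
  -- ### `dΦ = 0` along the segment `[0, t₀] × {y₀}`
  have hseg : ∀ t ∈ Set.Icc (0 : ℝ) t₀, fderiv ℝ Φ (E4.ofTimeSpace t y₀) = 0 := by
    intro t ht
    have hWt : W (E4.ofTimeSpace t y₀) ≠ 0 :=
      Kerr.dependenceWeight_ne_zero_segment hM hε₁0 hε₁R hε0.le hδ0 ht.1 ht.2
        (by rw [hrad t]; exact hεr)
    exact B.fderiv_eq_zero_of_weight hKc hKU hΦ2 hW1 hW0 hWK hsolK hflux hdataW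
      (x := E4.ofTimeSpace t y₀) (by simpa using ht.1) (by simpa using ht.2) hWt
  -- ### conclusion
  refine ⟨?_, ?_⟩
  · -- `Φ(t₀, y₀) = Φ(0, y₀) = 0`
    rw [hxeq]
    have hderiv : ∀ t, HasDerivAt (fun t ↦ Φ (E4.ofTimeSpace t y₀))
        (fderiv ℝ Φ (E4.ofTimeSpace t y₀) (E4.basisVector 0)) t := by
      intro t
      have hl : HasDerivAt (fun t : ℝ ↦ E4.ofTimeSpace t y₀) (E4.basisVector 0) t :=
        E4.hasDerivAt_ofTimeSpace_left t y₀
      have hF : HasFDerivAt Φ (fderiv ℝ Φ (E4.ofTimeSpace t y₀)) (E4.ofTimeSpace t y₀) :=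
        (hΦd _ (by rw [hrad t]; exact hx)).hasFDerivAt
      exact hF.comp_hasDerivAt t hl
    have hg : ∀ t ∈ Set.Icc 0 t₀, Φ (E4.ofTimeSpace t y₀) = Φ (E4.ofTimeSpace 0 y₀) := by
      refine constant_of_has_deriv_right_zero
        (fun t _ ↦ (hderiv t).continuousAt.continuousWithinAt) fun t ht ↦ ?_
      have := hderiv t
      rw [hseg t ⟨ht.1, ht.2.le⟩, _root_.zero_apply] at this
      exact this.hasDerivWithinAt
    rw [hg t₀ ⟨hx0, le_rfl⟩]
    exact hdata0
  · rw [hxeq]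
    exact hseg t₀ ⟨hx0, le_rfl⟩

/-- **Functions with the same Cauchy data on an open piece of the slice have the same differential
there** (local form of `E4.fderiv_eq_of_data_eq`): if `F, G : ℝ⁴ → ℝ` are differentiable at
`(0, y)`, agree at the slice points `(0, y')` for `y'` in an open set `O ∋ y`, and have the same
`∂_{t*}`-derivative at `(0, y)`, then `dF(0, y) = dG(0, y)` (the tangential derivatives are those
of `y' ↦ F(0, y') = G(0, y')` by the chain rule along `E4.ofTimeSpace 0`, whose differential is
`E4.spaceEmbed`). -/
theorem kerr_fderiv_eq_of_data_eqOn {F G : E4 → ℝ} {O : Set E3} (hO : IsOpen O) {y : E3}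
    (hy : y ∈ O) (hF : DifferentiableAt ℝ F (E4.ofTimeSpace 0 y))
    (hG : DifferentiableAt ℝ G (E4.ofTimeSpace 0 y))
    (h0 : ∀ y' ∈ O, F (E4.ofTimeSpace 0 y') = G (E4.ofTimeSpace 0 y'))
    (h1 : fderiv ℝ F (E4.ofTimeSpace 0 y) (E4.basisVector 0) =
      fderiv ℝ G (E4.ofTimeSpace 0 y) (E4.basisVector 0)) :
    fderiv ℝ F (E4.ofTimeSpace 0 y) = fderiv ℝ G (E4.ofTimeSpace 0 y) := by
  -- the tangential part
  have hev : (fun y' ↦ F (E4.ofTimeSpace 0 y')) =ᶠ[𝓝 y] fun y' ↦ G (E4.ofTimeSpace 0 y') :=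
    Filter.eventually_of_mem (hO.mem_nhds hy) h0
  have hcF : HasFDerivAt (fun y' ↦ F (E4.ofTimeSpace 0 y'))
      ((fderiv ℝ F (E4.ofTimeSpace 0 y)).comp E4.spaceEmbed) y :=
    hF.hasFDerivAt.comp y (E4.hasFDerivAt_ofTimeSpace 0 y)
  have hcG : HasFDerivAt (fun y' ↦ G (E4.ofTimeSpace 0 y'))
      ((fderiv ℝ G (E4.ofTimeSpace 0 y)).comp E4.spaceEmbed) y :=
    hG.hasFDerivAt.comp y (E4.hasFDerivAt_ofTimeSpace 0 y)
  have htan : (fderiv ℝ F (E4.ofTimeSpace 0 y)).comp E4.spaceEmbed =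
      (fderiv ℝ G (E4.ofTimeSpace 0 y)).comp E4.spaceEmbed := by
    rw [← hcF.fderiv, ← hcG.fderiv]
    exact hev.fderiv_eq
  ext v
  have hv : v = (v 0) • E4.basisVector 0 + E4.spaceEmbed (E4.spatial v) := by
    conv_lhs => rw [← E4.ofTimeSpace_time_spatial v]
    exact E4.ofTimeSpace_eq_smul_add' _ _
  rw [hv, map_add, map_add, map_smul, map_smul, h1]
  congr 1
  exact congrArg (fun L : E3 →L[ℝ] ℝ ↦ L (E4.spatial v)) htan

/-- The extension by zero of a difference is the difference of the extensions by zero. -/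
theorem kerr_extend_sub {U : TopologicalSpace.Opens E4} (ψ₁ ψ₂ : U → ℝ) :
    Function.extend Subtype.val (ψ₁ - ψ₂) 0 =
      Function.extend Subtype.val ψ₁ 0 - Function.extend Subtype.val ψ₂ 0 := by
  funext z
  by_cases hz : ∃ y : U, (y : E4) = z
  · obtain ⟨y, rfl⟩ := hz
    rw [Pi.sub_apply, Subtype.val_injective.extend_apply, Subtype.val_injective.extend_apply,
      Subtype.val_injective.extend_apply, Pi.sub_apply]
  · rw [Pi.sub_apply, Function.extend_apply' _ _ _ hz, Function.extend_apply' _ _ _ hz,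
      Function.extend_apply' _ _ _ hz]
    simp

/-- **Two solutions with the same Cauchy data on an exterior slice ball agree inside its domain of
dependence.** Let `(M, a)` be subextremal, `r₀ ≤ r₊`, and `ψ₁, ψ₂` smooth on `Kerr.region a r₀`
with `□_g ψᵢ = 0` on `{r > r₊}`. If `ψ̃₁ = ψ̃₂` at all slice points `(0, y')` with `r > r₊` and
`‖y' − y₀‖ < R₀`, and `∂_{t*}ψ̃₁ = ∂_{t*}ψ̃₂` there, then `ψ̃₁(x) = ψ̃₂(x)` and
`dψ̃₁(x) = dψ̃₂(x)` at every exterior point `x = (t₀, y₀)` with `0 ≤ t₀ < R₀` (`ψ̃ᵢ` the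
extensions by zero). Proof: `kerr_local_uniqueness` for `ψ₁ − ψ₂` (`dalembertian_sub`), whose
differential on the ball vanishes by `kerr_fderiv_eq_of_data_eqOn` (the exterior slice is open in
the slice). Bär–Ginoux–Pfäffle 2007, Cor. 3.2.4. -/
theorem kerr_local_uniqueness_two [Kerr.Facts] [Kerr.SliceFacts] {M a r₀ : ℝ}
    (hMa : Kerr.IsSubextremal M a) (hr₀ : r₀ ≤ Kerr.rPlus M a) {ψ₁ ψ₂ : Kerr.region a r₀ → ℝ}
    (hψ₁ : ContMDiff 𝓘(ℝ, E4) 𝓘(ℝ, ℝ) ∞ ψ₁) (hψ₂ : ContMDiff 𝓘(ℝ, E4) 𝓘(ℝ, ℝ) ∞ ψ₂)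
    (hsol₁ : ∀ x : Kerr.region a r₀, Kerr.rPlus M a < Kerr.radius a x.1 →
      (Kerr.smoothMetric M a r₀).toPseudoRiemannianMetric.dalembertian ψ₁ x = 0)
    (hsol₂ : ∀ x : Kerr.region a r₀, Kerr.rPlus M a < Kerr.radius a x.1 →
      (Kerr.smoothMetric M a r₀).toPseudoRiemannianMetric.dalembertian ψ₂ x = 0)
    {y₀ : E3} {R₀ : ℝ}
    (hdata0 : ∀ y' : E3, Kerr.rPlus M a < Kerr.radius a (E4.ofTimeSpace 0 y') → ‖y' - y₀‖ < R₀ →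
      Function.extend Subtype.val ψ₁ 0 (E4.ofTimeSpace 0 y') =
        Function.extend Subtype.val ψ₂ 0 (E4.ofTimeSpace 0 y'))
    (hdata1 : ∀ y' : E3, Kerr.rPlus M a < Kerr.radius a (E4.ofTimeSpace 0 y') → ‖y' - y₀‖ < R₀ →
      fderiv ℝ (Function.extend Subtype.val ψ₁ 0) (E4.ofTimeSpace 0 y') (E4.basisVector 0) =
        fderiv ℝ (Function.extend Subtype.val ψ₂ 0) (E4.ofTimeSpace 0 y') (E4.basisVector 0))
    {x : E4} (hx : Kerr.rPlus M a < Kerr.radius a x) (hx0 : 0 ≤ x 0) (hxR : x 0 < R₀)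
    (hxy : E4.spatial x = y₀) :
    Function.extend Subtype.val ψ₁ 0 x = Function.extend Subtype.val ψ₂ 0 x ∧
      fderiv ℝ (Function.extend Subtype.val ψ₁ 0) x =
        fderiv ℝ (Function.extend Subtype.val ψ₂ 0) x := by
  set Φ₁ : E4 → ℝ := Function.extend Subtype.val ψ₁ 0 with hΦ₁
  set Φ₂ : E4 → ℝ := Function.extend Subtype.val ψ₂ 0 with hΦ₂
  have hreg : ∀ z : E4, Kerr.rPlus M a < Kerr.radius a z → z ∈ Kerr.region a r₀ := fun z hz ↦
    kerr_mem_region_of_rPlus_lt hMa hr₀ hz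
  have hΦ₁d : ∀ z : E4, Kerr.rPlus M a < Kerr.radius a z → DifferentiableAt ℝ Φ₁ z := fun z hz ↦
    (contDiffAt_extend hψ₁ ⟨z, hreg z hz⟩).differentiableAt (by simp)
  have hΦ₂d : ∀ z : E4, Kerr.rPlus M a < Kerr.radius a z → DifferentiableAt ℝ Φ₂ z := fun z hz ↦
    (contDiffAt_extend hψ₂ ⟨z, hreg z hz⟩).differentiableAt (by simp)
  -- the difference
  set ψ : Kerr.region a r₀ → ℝ := ψ₁ - ψ₂ with hψ_def
  have hψ : ContMDiff 𝓘(ℝ, E4) 𝓘(ℝ, ℝ) ∞ ψ := hψ₁.sub hψ₂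
  have hext : Function.extend Subtype.val ψ 0 = Φ₁ - Φ₂ := kerr_extend_sub ψ₁ ψ₂
  have hsol : ∀ x : Kerr.region a r₀, Kerr.rPlus M a < Kerr.radius a x.1 →
      (Kerr.smoothMetric M a r₀).toPseudoRiemannianMetric.dalembertian ψ x = 0 := by
    intro z hz
    rw [hψ_def, dalembertian_sub (Kerr.smoothMetric M a r₀).toPseudoRiemannianMetric
      ((hψ₁ z).of_le (by norm_cast)) ((hψ₂ z).of_le (by norm_cast)),
      hsol₁ z hz, hsol₂ z hz, sub_zero]
  -- the exterior slice piece of the ball is open in the slice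
  set O : Set E3 := {y' : E3 | Kerr.rPlus M a < Kerr.radius a (E4.ofTimeSpace 0 y') ∧
    ‖y' - y₀‖ < R₀} with hO_def
  have hO : IsOpen O := by
    refine IsOpen.inter ?_ ?_
    · exact isOpen_lt continuous_const
        ((Kerr.continuous_radius a).comp (E4.continuous_ofTimeSpace 0))
    · exact isOpen_lt (continuous_norm.comp (continuous_id.sub continuous_const)) continuous_const
  -- the data of the difference vanish on the ball
  have hdata : ∀ z : E4, Kerr.rPlus M a < Kerr.radius a z → z 0 = 0 → ‖E4.spatial z - y₀‖ < R₀ →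
      fderiv ℝ (Function.extend Subtype.val ψ 0) z = 0 := by
    intro z hz hz0 hzR
    have hzeq : z = E4.ofTimeSpace 0 (E4.spatial z) := by
      conv_lhs => rw [← E4.ofTimeSpace_time_spatial z]
      rw [E4.time_apply, hz0]
    have hz' : Kerr.rPlus M a < Kerr.radius a (E4.ofTimeSpace 0 (E4.spatial z)) := by
      rw [← hzeq]; exact hz
    have hmem : E4.spatial z ∈ O := ⟨hz', hzR⟩
    have heq : fderiv ℝ Φ₁ (E4.ofTimeSpace 0 (E4.spatial z)) =
        fderiv ℝ Φ₂ (E4.ofTimeSpace 0 (E4.spatial z)) :=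
      kerr_fderiv_eq_of_data_eqOn hO hmem (hΦ₁d _ hz') (hΦ₂d _ hz')
        (fun y' hy' ↦ hdata0 y' hy'.1 hy'.2) (hdata1 _ hz' hzR)
    rw [hext, fderiv_sub (by rw [hzeq]; exact hΦ₁d _ hz') (by rw [hzeq]; exact hΦ₂d _ hz')]
    rw [hzeq, heq, sub_self]
  have hdata0' : Function.extend Subtype.val ψ 0 (E4.ofTimeSpace 0 y₀) = 0 := by
    have hy₀ : Kerr.rPlus M a < Kerr.radius a (E4.ofTimeSpace 0 y₀) := by
      rw [← hxy, Kerr.radius_ofTimeSpace_spatial]; exact hx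
    rw [hext, Pi.sub_apply, hdata0 y₀ hy₀ (by rw [sub_self, norm_zero]; linarith), sub_self]
  obtain ⟨h1, h2⟩ := kerr_local_uniqueness hMa hr₀ hψ hsol hdata hdata0' hx hx0 hxR hxy
  rw [hext] at h1 h2
  rw [fderiv_sub (hΦ₁d x hx) (hΦ₂d x hx)] at h2
  exact ⟨sub_eq_zero.mp h1, sub_eq_zero.mp h2⟩

end Summit.FinalStateConjecture.FinalStateConjecture.Theorems

end
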